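import Summits.AtomisticToContinuum.HydrodynamicLimit.Theses.JaynesSqueeze
import Literature.MathematicalPhysics.KineticTheory.HardSphereEulerProofs
import Literature.ModelTheory.ExponentialFields.SemialgebraicFlatReparam

/-!
# Inverting the activity–density relation of the dilute hard-sphere gas under tilts

Helper file for item `LocalGibbsConcentrationDilute` (stmt-AtomisticToContinuum-13460) of route
`JaynesSqueeze`. With `f_ex = hsExcessFreeEnergy`, the route's activity of a density profile `ρ`
at reduced diameter `σ` is `a = ρ e^{g_σ(ρ)}`, `g_σ(r) = f_ex(rσ³) + rσ³ f_ex'(rσ³)`, i.e.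
`a σ³ = Λ(ρσ³)` with `Λ(η) = η exp(f_ex(η) + η f_ex'(η))`.

* `exists_strictMonoOn_activity` — under `HsEosLowDensity` (`f_ex` real-analytic near `0`,
  `f_ex(0) = 0`), `Λ` is continuous and strictly increasing on `[0, η₃]` for some `η₃ > 0`
  (its derivative at `0` is `1`).
* `exists_continuous_inverse` — a continuous strictly monotone function on a compact interval
  has a continuous monotone inverse (via the partial inverse on a compact set,
  `Literature.ModelTheory.ExponentialFields.continuousOn_invFunOn_of_isCompact_injOn`).
The inversion under tilts (`exists_tilted_density`) is in the companion file
`JaynesSqueezeLocalGibbsConcentrationDiluteTiltedDensity`.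

No definitions (pure-proof helper file). prover-pitem-stmt-AtomisticToContinuum-13460-0.
-/

noncomputable section

namespace Summit.AtomisticToContinuum.HydrodynamicLimit.Theorems

open MeasureTheory Filter Topology Set
open Literature.Analysis.FluidPDE Literature.MathematicalPhysics.KineticTheory
open Summit.AtomisticToContinuum.HydrodynamicLimit.Theses.JaynesSqueeze

namespace LocalGibbsConcentration

section Inverse

/-- **Continuous monotone inverse of a continuous strictly increasing function on `[0, b]`.**
For `Λ` continuous and strictly increasing on `[0, b]` with `Λ 0 = 0` there is `Λinv : ℝ → ℝ`,
continuous on all of `ℝ` (it is constant outside `[0, Λ b]`), monotone, with values in `[0, b]`,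
inverse to `Λ` on `[0, b]` / `[0, Λ b]`. [folklore] -/
theorem exists_continuous_inverse {Λ : ℝ → ℝ} {b : ℝ} (hb : 0 ≤ b) (hcont : ContinuousOn Λ (Icc 0 b))
    (hmono : StrictMonoOn Λ (Icc 0 b)) (h0 : Λ 0 = 0) :
    ∃ Λinv : ℝ → ℝ, Continuous Λinv ∧ Monotone Λinv ∧ (∀ y, Λinv y ∈ Icc 0 b) ∧
      (∀ η ∈ Icc 0 b, Λinv (Λ η) = η) ∧ (∀ y ∈ Icc 0 (Λ b), Λ (Λinv y) = y) := by
  set s : Set ℝ := Icc 0 b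
  have h0s : (0 : ℝ) ∈ s := ⟨le_rfl, hb⟩
  have hbs : b ∈ s := ⟨hb, le_rfl⟩
  -- the image is `[0, Λ b]`
  have himage : Λ '' s = Icc 0 (Λ b) := by
    refine Subset.antisymm ?_ ?_
    · rintro y ⟨η, hη, rfl⟩
      exact ⟨h0 ▸ hmono.monotoneOn h0s hη hη.1, hmono.monotoneOn hη hbs hη.2⟩
    · have := intermediate_value_Icc hb hcont
      rwa [h0] at this
  set clamp : ℝ → ℝ := fun y => max 0 (min y (Λ b)) with hclamp
  have hΛb : 0 ≤ Λ b := h0 ▸ hmono.monotoneOn h0s hbs hb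
  have hclamp_mem : ∀ y, clamp y ∈ Icc 0 (Λ b) := fun y =>
    ⟨le_max_left _ _, max_le hΛb (min_le_right _ _)⟩
  have hclamp_id : ∀ y ∈ Icc 0 (Λ b), clamp y = y := fun y hy => by
    rw [hclamp]; simp only; rw [min_eq_left hy.2, max_eq_right hy.1]
  have hclamp_cont : Continuous clamp := by fun_prop
  have hclamp_mono : Monotone clamp := fun y y' h =>
    max_le_max le_rfl (min_le_min h le_rfl)
  set Λinv : ℝ → ℝ := fun y => Function.invFunOn Λ s (clamp y) with hΛinv
  have hinv_cont : ContinuousOn (Function.invFunOn Λ s) (Icc 0 (Λ b)) :=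
    himage ▸ Literature.ModelTheory.ExponentialFields.continuousOn_invFunOn_of_isCompact_injOn
      isCompact_Icc hcont hmono.injOn
  have hex : ∀ y ∈ Icc 0 (Λ b), ∃ a ∈ s, Λ a = y := fun y hy => by
    rw [← himage] at hy; exact hy
  refine ⟨Λinv, ?_, ?_, fun y => ?_, fun η hη => ?_, fun y hy => ?_⟩
  · exact hinv_cont.comp_continuous hclamp_cont hclamp_mem
  · intro y y' hyy'
    have hm := Function.invFunOn_mem (hex _ (hclamp_mem y))
    have hm' := Function.invFunOn_mem (hex _ (hclamp_mem y'))
    rw [← hmono.le_iff_le hm hm', Function.invFunOn_eq (hex _ (hclamp_mem y)),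
      Function.invFunOn_eq (hex _ (hclamp_mem y'))]
    exact hclamp_mono hyy'
  · exact Function.invFunOn_mem (hex _ (hclamp_mem y))
  · show Function.invFunOn Λ s (clamp (Λ η)) = η
    rw [hclamp_id _ ⟨h0 ▸ hmono.monotoneOn h0s hη hη.1, hmono.monotoneOn hη hbs hη.2⟩]
    exact hmono.injOn.leftInvOn_invFunOn hη
  · show Λ (Function.invFunOn Λ s (clamp y)) = y
    rw [hclamp_id y hy]
    exact Function.invFunOn_eq (hex y hy)

end Inverse

section Eos

/-- **The activity–density relation is strictly increasing at low density.** Under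
`HsEosLowDensity` there is `η₃ > 0` such that `Λ(η) = η exp(f_ex(η) + η f_ex'(η))`
(`f_ex = hsExcessFreeEnergy`) is continuous and strictly increasing on `[0, η₃]` (there
`f_ex` is the real-analytic `F`, and `Λ'(0) = e^{F(0)} = 1 > 0`). [folklore] -/
theorem exists_strictMonoOn_activity (hEos : HsEosLowDensity) :
    ∃ η₃ : ℝ, 0 < η₃ ∧
      ContinuousOn (fun η => η * Real.exp (hsExcessFreeEnergy η +
        η * deriv hsExcessFreeEnergy η)) (Icc 0 η₃) ∧
      StrictMonoOn (fun η => η * Real.exp (hsExcessFreeEnergy η +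
        η * deriv hsExcessFreeEnergy η)) (Icc 0 η₃) := by
  obtain ⟨η₀, hη₀, F, hF, hEq, hF0, -, -⟩ := hEos
  set U : Set ℝ := Ioo (-η₀) η₀ with hU
  have hUo : IsOpen U := isOpen_Ioo
  have hF' : AnalyticOnNhd ℝ (deriv F) U := hF.deriv
  have hF'' : AnalyticOnNhd ℝ (deriv (deriv F)) U := hF'.deriv
  -- `G_F = F + id · F'` and its derivative
  set G : ℝ → ℝ := fun η => F η + η * deriv F η with hG
  have hGderiv : ∀ η ∈ U, HasDerivAt G (2 * deriv F η + η * deriv (deriv F) η) η := by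
    intro η hη
    have h1 : HasDerivAt F (deriv F η) η := (hF.differentiableOn.differentiableAt
      (hUo.mem_nhds hη)).hasDerivAt
    have h2 : HasDerivAt (deriv F) (deriv (deriv F) η) η :=
      (hF'.differentiableOn.differentiableAt (hUo.mem_nhds hη)).hasDerivAt
    have h3 : HasDerivAt (fun y => F y + y * deriv F y)
        (deriv F η + (1 * deriv F η + η * deriv (deriv F) η)) η := h1.add ((hasDerivAt_id' η).mul h2)
    show HasDerivAt (fun y => F y + y * deriv F y) _ η
    exact h3.congr_deriv (by ring)
  -- bound on `G'` on the compact `[-η₀/2, η₀/2]`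
  have hKU : Icc (-(η₀ / 2)) (η₀ / 2) ⊆ U := fun η hη => ⟨by linarith [hη.1], by linarith [hη.2]⟩
  have hG'cont : ContinuousOn (fun η => 2 * deriv F η + η * deriv (deriv F) η) U :=
    (continuousOn_const.mul hF'.continuousOn).add (continuousOn_id.mul hF''.continuousOn)
  obtain ⟨B, hB⟩ := (isCompact_Icc.image_of_continuousOn (hG'cont.mono hKU)).isBounded.exists_norm_le
  have hB' : ∀ η ∈ Icc (-(η₀ / 2)) (η₀ / 2), |2 * deriv F η + η * deriv (deriv F) η| ≤ B :=
    fun η hη => (Real.norm_eq_abs _) ▸ hB _ ⟨η, hη, rfl⟩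
  have hBnn : 0 ≤ B := (abs_nonneg _).trans (hB' 0 ⟨by linarith, by linarith⟩)
  -- the radius
  set η₃ : ℝ := min (η₀ / 2) (1 / (2 * (B + 1))) with hη₃
  have hη₃pos : 0 < η₃ := lt_min (by linarith) (by positivity)
  have hη₃le : η₃ ≤ η₀ / 2 := min_le_left _ _
  have hη₃B : η₃ * (B + 1) ≤ 1 / 2 := by
    have : η₃ ≤ 1 / (2 * (B + 1)) := min_le_right _ _
    rw [le_div_iff₀ (by positivity)] at this
    linarith
  -- `Λ_F = id · exp ∘ G`, its derivative, positive on `(-η₃, η₃)`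
  set L : ℝ → ℝ := fun η => η * Real.exp (G η) with hL
  have hLderiv : ∀ η ∈ U, HasDerivAt L (Real.exp (G η) *
      (1 + η * (2 * deriv F η + η * deriv (deriv F) η))) η := by
    intro η hη
    have h : HasDerivAt (fun y => y * Real.exp (G y))
        (1 * Real.exp (G η) + η * (Real.exp (G η) * (2 * deriv F η + η * deriv (deriv F) η))) η :=
      (hasDerivAt_id' η).mul ((hGderiv η hη).exp)
    show HasDerivAt (fun y => y * Real.exp (G y)) _ η
    exact h.congr_deriv (by ring)
  have hIccU : Icc (-η₃) η₃ ⊆ U := fun η hη => hKU ⟨by linarith [hη.1], by linarith [hη.2]⟩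
  have hLcont : ContinuousOn L (Icc (-η₃) η₃) := fun η hη =>
    (hLderiv η (hIccU hη)).continuousAt.continuousWithinAt
  have hLmono : StrictMonoOn L (Icc (-η₃) η₃) := by
    refine strictMonoOn_of_deriv_pos (convex_Icc _ _) hLcont fun η hη => ?_
    rw [interior_Icc] at hη
    have hηU : η ∈ U := hIccU (Ioo_subset_Icc_self hη)
    rw [(hLderiv η hηU).deriv]
    refine mul_pos (Real.exp_pos _) ?_
    have hηK : η ∈ Icc (-(η₀ / 2)) (η₀ / 2) := ⟨by linarith [hη.1], by linarith [hη.2]⟩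
    have h1 : |η * (2 * deriv F η + η * deriv (deriv F) η)| ≤ 1 / 2 := by
      rw [abs_mul]
      calc |η| * |2 * deriv F η + η * deriv (deriv F) η| ≤ η₃ * B :=
            mul_le_mul (abs_le.2 ⟨by linarith [hη.1], hη.2.le⟩) (hB' η hηK) (abs_nonneg _)
              hη₃pos.le
        _ ≤ η₃ * (B + 1) := by nlinarith
        _ ≤ 1 / 2 := hη₃B
    linarith [neg_abs_le (η * (2 * deriv F η + η * deriv (deriv F) η))]
  -- transfer to the real `Λ` on `[0, η₃]`
  have hEqG : ∀ η ∈ Icc 0 η₃, hsExcessFreeEnergy η + η * deriv hsExcessFreeEnergy η = G η := by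
    intro η hη
    rcases hη.1.eq_or_lt with h | h
    · rw [← h, hG]
      simp only [zero_mul, add_zero]
      exact hEq ⟨le_rfl, hη₀⟩
    · have hηlt : η < η₀ := by linarith [hη.2]
      have hev : hsExcessFreeEnergy =ᶠ[𝓝 η] F := by
        have hmem : Ioo 0 η₀ ∈ 𝓝 η := isOpen_Ioo.mem_nhds ⟨h, hηlt⟩
        filter_upwards [hmem] with y hy using hEq ⟨hy.1.le, hy.2⟩
      rw [hG]
      simp only
      rw [hEq ⟨hη.1, hηlt⟩, hev.deriv_eq]
  have hEqL : EqOn (fun η => η * Real.exp (hsExcessFreeEnergy η +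
      η * deriv hsExcessFreeEnergy η)) L (Icc 0 η₃) := fun η hη => by
    simp only [hL]; rw [hEqG η hη]
  have hsub : Icc 0 η₃ ⊆ Icc (-η₃) η₃ := Icc_subset_Icc (by linarith) le_rfl
  refine ⟨η₃, hη₃pos, (hLcont.mono hsub).congr hEqL, fun a ha b hb hab => ?_⟩
  show (fun η => η * Real.exp (hsExcessFreeEnergy η + η * deriv hsExcessFreeEnergy η)) a <
    (fun η => η * Real.exp (hsExcessFreeEnergy η + η * deriv hsExcessFreeEnergy η)) b
  rw [hEqL ha, hEqL hb]
  exact hLmono (hsub ha) (hsub hb) hab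

end Eos

end LocalGibbsConcentration

end Summit.AtomisticToContinuum.HydrodynamicLimit.Theorems
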